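import Literature.Analysis.FluidPDE.PassiveVectorGalerkinLimit
import Literature.Analysis.FluidPDE.NSHopfGalerkinLimit
import Literature.Analysis.FunctionSpaces.TorusWeakFormBookkeeping
import Literature.Analysis.FunctionSpaces.TorusFourierSeries
import Literature.Analysis.FluidPDE.NSHopfWeakConvergence
import HarnessLib

/-!
# The Fourier–Galerkin scheme for the passive solenoidal vector (`A = 0`) with a trigonometric-polynomial
  carrier, III: the Galerkin equations in weak form

Analysis/FluidPDE proof-support file (theorems only; no named facts), sequel of `PassiveVectorGalerkinLimit`.
For the data `Torus.PVSetup κ b B β C Sec w₀` and a Galerkin order `N` with `B ⊆ freqBall N` (all carrier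
modes resolved), the Galerkin approximation `u_N = PVSetup.galerkinApprox N` satisfies the weak formulation
of `∂ₜw + (b·∇)w + ∇π = κΔw` against every divergence-free space–time test field `Ψ` on `[0, T)`, up to the
truncation of the test field inside the transport term:

  `∫_{(0,T)} ∫ ⟪u_N, ∂ₜΨ + (b·∇)(P_N Ψ) + κΔΨ⟫ + ∫ ⟪P_N w₀, Ψ(0)⟫ = 0`

(`PVSetup.galerkin_weak_identity`; Robinson–Rodrigo–Sadowski 2016, Thm. 4.4 Step 4, (4.5) tested and
integrated by parts in time; Constantin–Foias 1988, (8.5)). The proof is on the Fourier side: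
`f(t) = ∫⟪u_N(t), Ψ(t)⟫ = ∑_{k∈S} ⟪α_N(t)(k), Ψ̂(t)(k)⟫_ℝ` is differentiated with the Galerkin ODE and
`d/dt Ψ̂(t)(k) = 𝓕(∂ₜΨ(t))(k)`, and `∑_k ⟪V_k, Ψ̂_k⟫_ℝ = κ∫⟪u_N, ΔΨ⟫ + ∫⟪u_N, (b·∇)P_NΨ⟫` by Parseval, the
self-adjointness of the Leray symbol on transversal vectors and the antisymmetry
`∫⟪(b·∇)u, v⟫ = -∫⟪u, (b·∇)v⟫` (`integral_inner_convect_eq_neg`). Also: weak `L²` convergence of the slices of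
a Galerkin limit (`IsGalerkinLimit.tendsto_integral_inner`, from the tree's
`Torus.tendsto_integral_inner_of_tendsto_mFourierCoeff`). The passage to the limit `N → ∞` in the weak form is the
object of the sequel.

## References

* J. C. Robinson, J. L. Rodrigo, W. Sadowski, *The three-dimensional Navier–Stokes equations*
  (CUP 2016), Thm. 4.4 Step 4, (4.5), Lemma 3.2. [`RobinsonRodrigoSadowski2016`]
* P. Constantin, C. Foias, *Navier–Stokes Equations* (Chicago 1988), Ch. 8, (8.5). [`ConstantinFoias1988`]
-/

open MeasureTheory Set Filter Topology UnitAddTorus Metric Function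
open scoped ENNReal NNReal InnerProductSpace

noncomputable section

namespace Literature.Analysis.FluidPDE

namespace Torus

open FunctionSpaces.Torus FunctionSpaces

variable {d : Type*} [Fintype d] [DecidableEq d]

/-! ## Antisymmetry of the transport pairing -/

section Antisymmetry

/-- **Antisymmetry of the trilinear form**: `∫⟪(b·∇)u, v⟫ = -∫⟪u, (b·∇)v⟫` for smooth `u, v` and a smooth
divergence-free `b` (`D⟪u,v⟫[b] = ⟪u, Dv[b]⟫ + ⟪Du[b], v⟫` integrates to zero; Robinson–Rodrigo–Sadowski
2016, Lemma 3.2 / (3.3)). [cite: RobinsonRodrigoSadowski2016, Lemma 3.2] -/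
theorem integral_inner_convect_eq_neg {G : Type*} [NormedAddCommGroup G] [InnerProductSpace ℝ G]
    [CompleteSpace G] {b : UnitAddTorus d → EuclideanSpace ℝ d} {u v : UnitAddTorus d → G}
    (hb : IsSmooth b) (hbdiv : IsDivFree b) (hu : IsSmooth u) (hv : IsSmooth v) :
    ∫ x, ⟪FunctionSpaces.Torus.convect b u x, v x⟫_ℝ = -∫ x, ⟪u x, FunctionSpaces.Torus.convect b v x⟫_ℝ := by
  have h : ∀ x, FunctionSpaces.Torus.fderiv (fun y => ⟪u y, v y⟫_ℝ) x (b x) =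
      ⟪u x, FunctionSpaces.Torus.convect b v x⟫_ℝ + ⟪FunctionSpaces.Torus.convect b u x, v x⟫_ℝ := by
    intro x
    rw [fderiv_inner_apply (hu.isContDiff (by simp)) (hv.isContDiff (by simp))]
    rfl
  have h0 := integral_fderiv_apply_eq_zero_of_isDivFree hb (hu.inner hv) hbdiv
  simp_rw [h] at h0
  have hi1 : Integrable (fun x => ⟪u x, FunctionSpaces.Torus.convect b v x⟫_ℝ) volume :=
    memLp_one_iff_integrable.1 ((hu.inner (hb.convect hv)).memLp 1)
  have hi2 : Integrable (fun x => ⟪FunctionSpaces.Torus.convect b u x, v x⟫_ℝ) volume :=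
    memLp_one_iff_integrable.1 (((hb.convect hu).inner hv).memLp 1)
  rw [integral_add hi1 hi2] at h0
  linarith

end Antisymmetry

/-! ## The Galerkin equations in weak form -/

section GalerkinWeak

variable {b : ℝ → UnitAddTorus d → EuclideanSpace ℝ d} {B : Finset (d → ℤ)}
  {β : ℝ → (d → ℤ) → EuclideanSpace ℂ d} {C κ : ℝ} {Sec : Set (d → ℤ)}
  {w₀ : UnitAddTorus d → EuclideanSpace ℝ d}

/-- When all carrier modes are resolved (`B ⊆ freqBall N`), the truncated carrier IS the carrier:
`realTrigPoly (freqBall N) (β_N t) = b t`. [cite: RobinsonRodrigoSadowski2016, Thm. 4.4 Step 1 (4.5)] -/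
theorem realTrigPoly_carrierTrunc_eq (hc : TrigPolyCarrier b B β C) {N : ℕ} (hBN : B ⊆ freqBall N) (t : ℝ) :
    realTrigPoly (freqBall N) (coeffExt (freqBall N) (carrierTrunc β N t)) = b t := by
  have e : coeffExt (freqBall N) (carrierTrunc β N t) = coeffExt (freqBall N) (fun k : ↥(freqBall (d := d) N) => β t k) := rfl
  rw [hc.eq t, e, realTrigPoly_coeffExt_restrict, realTrigPoly_eq_comp, realTrigPoly_eq_comp,
    trigPoly_subset hBN fun k _ hkB => hc.support t k hkB]

/-- The initial Galerkin approximation is the truncated datum `P_N w₀`. [cite: RobinsonRodrigoSadowski2016, Thm. 4.4 Step 1 (4.3)] -/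
theorem PVSetup.galerkinApprox_zero (h : PVSetup κ b B β C Sec w₀) (N : ℕ) :
    h.galerkinApprox N 0 = fourierTruncate N w₀ := by
  rw [PVSetup.galerkinApprox, fourierTruncate_eq]
  have h0 : h.galerkinCoeffAt N 0 = coeffExt (freqBall N) (datumTrunc w₀ N) := by
    funext k; rw [PVSetup.galerkinCoeffAt, (h.galerkinCoeff_spec N).1]
  rw [h0]
  exact realTrigPoly_coeffExt_restrict _

/-- The pairing of the Galerkin approximation with an `L²` field, on the Fourier side:
`∫⟪u_N(t), g⟫ = ∑_{k ∈ freqBall N} ⟪α_N(t)(k), ĝ(k)⟫_ℝ`. [cite: Grafakos2014, Prop. 3.2.7 (3)] -/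
theorem PVSetup.integral_inner_galerkinApprox (h : PVSetup κ b B β C Sec w₀) (N : ℕ) (t : ℝ)
    {g : UnitAddTorus d → EuclideanSpace ℝ d} (hg : MemLp g 2 volume) :
    ∫ x, ⟪h.galerkinApprox N t x, g x⟫_ℝ =
      ∑ k : ↥(freqBall (d := d) N), ⟪h.galerkinCoeff N t k, mFourierCoeff (EuclideanSpace.complexify ∘ g) k⟫_ℝ := by
  rw [PVSetup.galerkinApprox, integral_inner_realTrigPoly_left neg_mem_freqBall_of_mem (h.isConjSymm_galerkinCoeffAt N t) hg,
    ← Finset.sum_coe_sort]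
  refine Finset.sum_congr rfl fun k _ => ?_
  rw [real_inner_eq_re_inner_euclidean, PVSetup.galerkinCoeffAt, coeffExt_coe]

/-- **The tested right-hand side of the Galerkin system, on the Fourier side.** For `B ⊆ freqBall N`
and a smooth divergence-free `a`:
`∑_{k∈S} ⟪V(β_N t, α_N t)_k, â(k)⟫_ℝ = κ ∫⟪u_N(t), Δa⟫ + ∫⟪u_N(t), (b(t)·∇)(P_N a)⟫`
(Stokes term by `𝓕(Δa) = -4π²|k|²â` and Parseval; transport term by `Π_k â_k = â_k`, Parseval against the
band-limited `P_N a` and antisymmetry). [cite: RobinsonRodrigoSadowski2016, Thm. 4.4 Step 1 (4.5)] -/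
theorem PVSetup.sum_inner_rhs_eq (h : PVSetup κ b B β C Sec w₀) {N : ℕ} (hBN : B ⊆ freqBall N) (t : ℝ)
    {a : UnitAddTorus d → EuclideanSpace ℝ d} (ha : IsSmooth a) (hadiv : IsDivFree a) :
    ∑ k : ↥(freqBall (d := d) N), ⟪pvGalerkinRHS (freqBall N) κ (carrierTrunc β N t) (h.galerkinCoeff N t) k,
        mFourierCoeff (EuclideanSpace.complexify ∘ a) k⟫_ℝ =
      κ * (∫ x, ⟪h.galerkinApprox N t x, FunctionSpaces.Torus.laplacian a x⟫_ℝ) +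
        ∫ x, ⟪h.galerkinApprox N t x, FunctionSpaces.Torus.convect (b t) (fourierTruncate N a) x⟫_ℝ := by
  have hS : ∀ k ∈ freqBall (d := d) N, -k ∈ freqBall N := neg_mem_freqBall_of_mem
  have hcsymm : IsConjSymm (h.galerkinCoeffAt N t) := h.isConjSymm_galerkinCoeffAt N t
  have hβsymm : IsConjSymm (coeffExt (freqBall N) (carrierTrunc β N t)) :=
    (isRealCoeff_carrierTrunc h.carrier N t).isConjSymm_coeffExt hS
  have hβT : IsTransversal (freqBall N) (coeffExt (freqBall N) (carrierTrunc β N t)) :=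
    (isSolenoidalCoeff_carrierTrunc h.carrier N t).isTransversal_coeffExt
  have hâ : ∀ k, ∑ i, (k i : ℂ) * mFourierCoeff (EuclideanSpace.complexify ∘ a) k i = 0 :=
    fun k => hadiv.sum_mul_mFourierCoeff_eq_zero ha k
  have hu : IsSmooth (h.galerkinApprox N t) := isSmooth_realTrigPoly _ _
  have hbN : IsSmooth (realTrigPoly (freqBall N) (coeffExt (freqBall N) (carrierTrunc β N t))) :=
    isSmooth_realTrigPoly _ _
  have hbNdiv : IsDivFree (realTrigPoly (freqBall N) (coeffExt (freqBall N) (carrierTrunc β N t))) :=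
    isDivFree_realTrigPoly hβT
  have hbeq := realTrigPoly_carrierTrunc_eq h.carrier hBN t
  -- split the field termwise: `⟪V k, â k⟫_ℝ = -κ4π²|k|² Re⟪c k, â k⟫ - Re⟪conv k, â k⟫`
  have hsplit : ∀ k : ↥(freqBall (d := d) N),
      ⟪pvGalerkinRHS (freqBall N) κ (carrierTrunc β N t) (h.galerkinCoeff N t) k,
        mFourierCoeff (EuclideanSpace.complexify ∘ a) k⟫_ℝ =
      κ * (inner ℂ (h.galerkinCoeffAt N t k) (-(((4 * Real.pi ^ 2 * freqNormSq (k : d → ℤ) : ℝ) : ℂ) •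
          mFourierCoeff (EuclideanSpace.complexify ∘ a) k))).re -
        (inner ℂ (convectionCoeff (freqBall N) (coeffExt (freqBall N) (carrierTrunc β N t)) (h.galerkinCoeffAt N t) k)
          (mFourierCoeff (EuclideanSpace.complexify ∘ a) k)).re := by
    intro k
    have e : pvGalerkinRHS (freqBall N) κ (carrierTrunc β N t) (h.galerkinCoeff N t) k =
        pvGalerkinField κ (freqBall N) (coeffExt (freqBall N) (carrierTrunc β N t)) (h.galerkinCoeffAt N t) k := rfl
    have e1 : (inner ℂ (-(((κ * (4 * Real.pi ^ 2 * freqNormSq (k : d → ℤ)) : ℝ) : ℂ) • h.galerkinCoeffAt N t k))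
        (mFourierCoeff (EuclideanSpace.complexify ∘ a) k)).re =
        -(κ * (4 * Real.pi ^ 2 * freqNormSq (k : d → ℤ))) *
          (inner ℂ (h.galerkinCoeffAt N t k) (mFourierCoeff (EuclideanSpace.complexify ∘ a) k)).re := by
      rw [inner_neg_left, Complex.neg_re, inner_smul_left, Complex.conj_ofReal, Complex.re_ofReal_mul]
      ring
    have e2 : (inner ℂ (h.galerkinCoeffAt N t k) (-(((4 * Real.pi ^ 2 * freqNormSq (k : d → ℤ) : ℝ) : ℂ) •
        mFourierCoeff (EuclideanSpace.complexify ∘ a) k))).re =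
        -(4 * Real.pi ^ 2 * freqNormSq (k : d → ℤ)) *
          (inner ℂ (h.galerkinCoeffAt N t k) (mFourierCoeff (EuclideanSpace.complexify ∘ a) k)).re := by
      rw [inner_neg_right, Complex.neg_re, inner_smul_right, Complex.re_ofReal_mul]
      ring
    rw [real_inner_eq_re_inner_euclidean, e, pvGalerkinField_def, inner_sub_left, Complex.sub_re,
      inner_leraySym_left_of_transversal _ _ (hâ k), e1, e2]
    ring
  -- the Stokes term
  have hStokes : ∑ k : ↥(freqBall (d := d) N), (inner ℂ (h.galerkinCoeffAt N t k)
      (-(((4 * Real.pi ^ 2 * freqNormSq (k : d → ℤ) : ℝ) : ℂ) • mFourierCoeff (EuclideanSpace.complexify ∘ a) k))).re =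
      ∫ x, ⟪h.galerkinApprox N t x, FunctionSpaces.Torus.laplacian a x⟫_ℝ := by
    rw [PVSetup.galerkinApprox, integral_inner_realTrigPoly_left hS hcsymm (ha.laplacian.memLp 2),
      ← Finset.sum_coe_sort (freqBall (d := d) N)]
    refine Finset.sum_congr rfl fun k _ => ?_
    rw [mFourierCoeff_complexify_laplacian ha]
  -- the transport term
  have hTrans : ∑ k : ↥(freqBall (d := d) N),
      (inner ℂ (convectionCoeff (freqBall N) (coeffExt (freqBall N) (carrierTrunc β N t)) (h.galerkinCoeffAt N t) k)
        (mFourierCoeff (EuclideanSpace.complexify ∘ a) k)).re =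
      -∫ x, ⟪h.galerkinApprox N t x, FunctionSpaces.Torus.convect (b t) (fourierTruncate N a) x⟫_ℝ := by
    have hF : MemLp (FunctionSpaces.Torus.convect (realTrigPoly (freqBall N) (coeffExt (freqBall N) (carrierTrunc β N t)))
        (h.galerkinApprox N t)) 2 volume := (hbN.convect hu).memLp 2
    have hasymm : IsConjSymm (fun k => mFourierCoeff (EuclideanSpace.complexify ∘ a) k) :=
      isConjSymm_mFourierCoeff ((ha.memLp 2).integrable one_le_two)
    have hP := integral_inner_realTrigPoly_right hS hasymm hF
    have hcoef : ∀ k, mFourierCoeff (EuclideanSpace.complexify ∘ FunctionSpaces.Torus.convect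
        (realTrigPoly (freqBall N) (coeffExt (freqBall N) (carrierTrunc β N t))) (h.galerkinApprox N t)) k =
        convectionCoeff (freqBall N) (coeffExt (freqBall N) (carrierTrunc β N t)) (h.galerkinCoeffAt N t) k := by
      intro k
      rw [PVSetup.galerkinApprox]
      exact mFourierCoeff_convect_realTrigPoly hS hβsymm hcsymm k
    simp_rw [hcoef] at hP
    rw [← Finset.sum_coe_sort (freqBall (d := d) N)] at hP
    rw [← hP, ← fourierTruncate_eq, integral_inner_convect_eq_neg hbN hbNdiv hu (isSmooth_fourierTruncate N a), hbeq]
  calc ∑ k : ↥(freqBall (d := d) N), ⟪pvGalerkinRHS (freqBall N) κ (carrierTrunc β N t) (h.galerkinCoeff N t) k,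
        mFourierCoeff (EuclideanSpace.complexify ∘ a) k⟫_ℝ
      = ∑ k : ↥(freqBall (d := d) N), (κ * (inner ℂ (h.galerkinCoeffAt N t k)
          (-(((4 * Real.pi ^ 2 * freqNormSq (k : d → ℤ) : ℝ) : ℂ) • mFourierCoeff (EuclideanSpace.complexify ∘ a) k))).re -
        (inner ℂ (convectionCoeff (freqBall N) (coeffExt (freqBall N) (carrierTrunc β N t)) (h.galerkinCoeffAt N t) k)
          (mFourierCoeff (EuclideanSpace.complexify ∘ a) k)).re) := Finset.sum_congr rfl fun k _ => hsplit k
    _ = κ * ∑ k : ↥(freqBall (d := d) N), (inner ℂ (h.galerkinCoeffAt N t k)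
          (-(((4 * Real.pi ^ 2 * freqNormSq (k : d → ℤ) : ℝ) : ℂ) • mFourierCoeff (EuclideanSpace.complexify ∘ a) k))).re -
        ∑ k : ↥(freqBall (d := d) N),
          (inner ℂ (convectionCoeff (freqBall N) (coeffExt (freqBall N) (carrierTrunc β N t)) (h.galerkinCoeffAt N t) k)
            (mFourierCoeff (EuclideanSpace.complexify ∘ a) k)).re := by
        rw [Finset.sum_sub_distrib, Finset.mul_sum]
    _ = _ := by rw [hStokes, hTrans]; ring

omit [DecidableEq d] in
/-- The Fourier coefficients of the (identically vanishing) final slice of a test field vanish. [cite: RobinsonRodrigoSadowski2016, Thm. 4.4 Step 4 (4.5)] -/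
theorem mFourierCoeff_test_eq_zero_of_le {T : ℝ} {Ψ : ℝ → UnitAddTorus d → EuclideanSpace ℝ d}
    (hΨ : IsSpaceTimeTest T Ψ) {t : ℝ} (ht : T ≤ t) (k : d → ℤ) :
    mFourierCoeff (EuclideanSpace.complexify ∘ Ψ t) k = 0 := by
  rw [hΨ.eq_zero_of_le ht]
  have : (EuclideanSpace.complexify ∘ (0 : UnitAddTorus d → EuclideanSpace ℝ d)) = fun _ => 0 := by
    funext x; simp
  rw [this, mFourierCoeff_eq_integral_volume]
  simp

/-- **The Galerkin equations in weak form** (Robinson–Rodrigo–Sadowski 2016, Thm. 4.4 Step 4: (4.5) tested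
against a space–time test field and integrated by parts in time; Constantin–Foias 1988, (8.5)). For
`B ⊆ freqBall N`, `T > 0` and a divergence-free space–time test field `Ψ` on `[0, T)`, the Galerkin
approximation `u_N` satisfies
`∫_{(0,T)} ∫ ⟪u_N, ∂ₜΨ + (b·∇)(P_N Ψ) + κΔΨ⟫ + ∫ ⟪P_N w₀, Ψ(0)⟫ = 0`
— the weak formulation of the passive-vector equation with the test field truncated inside the transport
term. [cite: RobinsonRodrigoSadowski2016, Thm. 4.4 Step 4 (4.5)] -/
theorem PVSetup.galerkin_weak_identity (h : PVSetup κ b B β C Sec w₀) {N : ℕ} (hBN : B ⊆ freqBall N)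
    {T : ℝ} (hT : 0 < T) {Ψ : ℝ → UnitAddTorus d → EuclideanSpace ℝ d} (hΨ : IsSpaceTimeTest T Ψ)
    (hΨdiv : ∀ t, IsDivFree (Ψ t)) :
    (∫ t in Ioo 0 T, ∫ x, ⟪h.galerkinApprox N t x, FunctionSpaces.Torus.timeDeriv Ψ t x +
        FunctionSpaces.Torus.convect (b t) (fourierTruncate N (Ψ t)) x + κ • FunctionSpaces.Torus.laplacian (Ψ t) x⟫_ℝ) +
      ∫ x, ⟪fourierTruncate N w₀ x, Ψ 0 x⟫_ℝ = 0 := by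
  obtain ⟨hα0, hmem, hcont, hsol, -⟩ := h.galerkinCoeff_spec N
  -- Fourier-side pairing `f`, its derivative `g`, and the spatial form `G` of `g`
  set Ψh : ℝ → (d → ℤ) → EuclideanSpace ℂ d := fun t k => mFourierCoeff (EuclideanSpace.complexify ∘ Ψ t) k with hΨh
  set Ψh' : ℝ → (d → ℤ) → EuclideanSpace ℂ d :=
    fun t k => mFourierCoeff (EuclideanSpace.complexify ∘ FunctionSpaces.Torus.timeDeriv Ψ t) k with hΨh'
  set V : ℝ → ↥(freqBall (d := d) N) → EuclideanSpace ℂ d :=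
    fun t => pvGalerkinRHS (freqBall N) κ (carrierTrunc β N t) (h.galerkinCoeff N t) with hV
  set f : ℝ → ℝ := fun t => ∑ k : ↥(freqBall (d := d) N), ⟪h.galerkinCoeff N t k, Ψh t k⟫_ℝ with hf
  set g : ℝ → ℝ := fun t => ∑ k : ↥(freqBall (d := d) N),
    (⟪h.galerkinCoeff N t k, Ψh' t k⟫_ℝ + ⟪V t k, Ψh t k⟫_ℝ) with hg
  set G : ℝ → ℝ := fun t => ∫ x, ⟪h.galerkinApprox N t x, FunctionSpaces.Torus.timeDeriv Ψ t x +
    FunctionSpaces.Torus.convect (b t) (fourierTruncate N (Ψ t)) x + κ • FunctionSpaces.Torus.laplacian (Ψ t) x⟫_ℝ with hG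
  -- (1) `f' = g` within `[0, T]`
  have hderiv : ∀ t ∈ Icc 0 T, HasDerivWithinAt f (g t) (Icc 0 T) t := by
    intro t ht
    have hsum := HasDerivWithinAt.fun_sum (u := (Finset.univ : Finset ↥(freqBall (d := d) N)))
      (A := fun k s => ⟪h.galerkinCoeff N s k, Ψh s k⟫_ℝ)
      (A' := fun k => ⟪h.galerkinCoeff N t k, Ψh' t k⟫_ℝ + ⟪V t k, Ψh t k⟫_ℝ) (x := t) (s := Icc 0 T) fun k _ => ?_
    · exact hsum
    · have hαk : HasDerivWithinAt (fun s => h.galerkinCoeff N s k) (V t k) (Icc 0 T) t :=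
        (ContinuousLinearMap.proj (R := ℝ) (φ := fun _ : ↥(freqBall (d := d) N) => EuclideanSpace ℂ d) k).hasFDerivAt
          |>.comp_hasDerivWithinAt t (hsol T t ht)
      have hΨk : HasDerivWithinAt (fun s => Ψh s k) (Ψh' t k) (Icc 0 T) t :=
        (hasDerivAt_mFourierCoeff_slice (hΨ.isSmoothSpaceTimeOn univ) (k : d → ℤ) t).hasDerivWithinAt
      exact hαk.inner ℝ hΨk
  -- (2) `g` is continuous on `[0, T]`
  have hgcont : ContinuousOn g (Icc 0 T) := by
    have hαc : ∀ k : ↥(freqBall (d := d) N), ContinuousOn (fun t => h.galerkinCoeff N t k) (Icc 0 T) := fun k =>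
      ((continuous_apply k).comp_continuousOn hcont).mono Icc_subset_Ici_self
    have hVc : ∀ k : ↥(freqBall (d := d) N), ContinuousOn (fun t => V t k) (Icc 0 T) := fun k =>
      ((continuous_apply k).comp_continuousOn
        (ContinuousOn.pvGalerkinRHS κ (continuous_carrierTrunc h.carrier N).continuousOn hcont)).mono Icc_subset_Ici_self
    have hΨc : ∀ k : d → ℤ, Continuous fun t => Ψh t k := fun k => hΨ.continuous_mFourierCoeff k
    have hΨ'c : ∀ k : d → ℤ, Continuous fun t => Ψh' t k := fun k => hΨ.timeDeriv.continuous_mFourierCoeff k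
    refine continuousOn_finsetSum _ fun k _ => ?_
    exact ((hαc k).inner (hΨ'c k).continuousOn).add ((hVc k).inner (hΨc k).continuousOn)
  -- (3) FTC: `∫₀ᵀ g = f T - f 0 = -f 0`
  have hfcont : ContinuousOn f (Icc 0 T) := fun t ht => (hderiv t ht).continuousWithinAt
  have hFTC := intervalIntegral.integral_eq_sub_of_hasDeriv_right_of_le hT.le hfcont
    (fun t ht => (hderiv t (Ioo_subset_Icc_self ht)).mono_of_mem_nhdsWithin
      (mem_nhdsWithin.2 ⟨Iio T, isOpen_Iio, ht.2, fun z hz => ⟨(ht.1.trans hz.2).le, le_of_lt hz.1⟩⟩))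
    (hgcont.intervalIntegrable_of_Icc hT.le)
  have hfT : f T = 0 := by
    simp only [hf, hΨh, mFourierCoeff_test_eq_zero_of_le hΨ le_rfl, inner_zero_right, Finset.sum_const_zero]
  have hf0 : f 0 = ∫ x, ⟪fourierTruncate N w₀ x, Ψ 0 x⟫_ℝ := by
    rw [← h.galerkinApprox_zero N, h.integral_inner_galerkinApprox N 0 ((hΨ.isSmooth_slice 0).memLp 2)]
  -- (4) `g = G` pointwise
  have hgG : ∀ t, g t = G t := by
    intro t
    have hu : Integrable (h.galerkinApprox N t) volume := (memLp_realTrigPoly _ _ 2).integrable one_le_two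
    have hc1 : Continuous (FunctionSpaces.Torus.timeDeriv Ψ t) := (hΨ.timeDeriv.isSmooth_slice t).continuous
    have hc2 : Continuous (FunctionSpaces.Torus.convect (b t) (fourierTruncate N (Ψ t))) := by
      rw [← realTrigPoly_carrierTrunc_eq h.carrier hBN t]
      exact ((isSmooth_realTrigPoly _ _).convect (isSmooth_fourierTruncate N (Ψ t))).continuous
    have hc3 : Continuous fun x => κ • FunctionSpaces.Torus.laplacian (Ψ t) x :=
      ((hΨ.isSmooth_slice t).laplacian.continuous).const_smul κ
    have i1 := FunctionSpaces.Torus.integrable_inner_of_continuous hu hc1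
    have i2 := FunctionSpaces.Torus.integrable_inner_of_continuous hu hc2
    have i3 := FunctionSpaces.Torus.integrable_inner_of_continuous hu hc3
    have hsplit : G t = (∫ x, ⟪h.galerkinApprox N t x, FunctionSpaces.Torus.timeDeriv Ψ t x⟫_ℝ) +
        ((∫ x, ⟪h.galerkinApprox N t x, FunctionSpaces.Torus.convect (b t) (fourierTruncate N (Ψ t)) x⟫_ℝ) +
          κ * ∫ x, ⟪h.galerkinApprox N t x, FunctionSpaces.Torus.laplacian (Ψ t) x⟫_ℝ) := by
      simp only [hG]
      simp_rw [inner_add_right]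
      have i12 : Integrable (fun x => ⟪h.galerkinApprox N t x, FunctionSpaces.Torus.timeDeriv Ψ t x⟫_ℝ +
          ⟪h.galerkinApprox N t x, FunctionSpaces.Torus.convect (b t) (fourierTruncate N (Ψ t)) x⟫_ℝ) volume := i1.add i2
      rw [integral_add i12 i3, integral_add i1 i2]
      simp_rw [real_inner_smul_right]
      rw [integral_const_mul, add_assoc]
    have hrhs := h.sum_inner_rhs_eq hBN t (hΨ.isSmooth_slice t) (hΨdiv t)
    rw [hsplit, h.integral_inner_galerkinApprox N t ((hΨ.timeDeriv.isSmooth_slice t).memLp 2)]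
    simp only [hg, hV, hΨh, hΨh', Finset.sum_add_distrib]
    rw [hrhs]
    ring
  -- (5) assemble
  have hIoo : (∫ t in Ioo 0 T, G t) = ∫ t in (0:ℝ)..T, g t := by
    rw [intervalIntegral.integral_of_le hT.le, integral_Ioc_eq_integral_Ioo]
    exact setIntegral_congr_fun measurableSet_Ioo fun t _ => (hgG t).symm
  change (∫ t in Ioo 0 T, G t) + ∫ x, ⟪fourierTruncate N w₀ x, Ψ 0 x⟫_ℝ = 0
  rw [hIoo, hFTC, hfT, hf0]
  ring

end GalerkinWeak

/-! ## Weak convergence of the slices of a Galerkin limit -/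

section WeakNull

variable {b : ℝ → UnitAddTorus d → EuclideanSpace ℝ d} {B : Finset (d → ℤ)}
  {β : ℝ → (d → ℤ) → EuclideanSpace ℂ d} {C κ : ℝ} {Sec : Set (d → ℤ)}
  {w₀ : UnitAddTorus d → EuclideanSpace ℝ d}
  {h : PVSetup κ b B β C Sec w₀} {φ : ℕ → ℕ} {c : ℝ → (d → ℤ) → EuclideanSpace ℂ d}
  {w : ℝ → UnitAddTorus d → EuclideanSpace ℝ d}

/-- **Weak convergence of the slices of a Galerkin limit**: `∫⟪u_{φ n}(t), g⟫ → ∫⟪w(t), g⟫` for every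
`g ∈ L²(T^d; ℝ^d)` and `t ≥ 0` (the differences are bounded in `L²` with all Fourier modes tending to zero). [cite: RobinsonRodrigoSadowski2016, Lemma A.20] -/
theorem PVSetup.IsGalerkinLimit.tendsto_integral_inner (hl : h.IsGalerkinLimit φ c w) {t : ℝ} (ht : 0 ≤ t)
    {g : UnitAddTorus d → EuclideanSpace ℝ d} (hg : MemLp g 2 volume) :
    Tendsto (fun n => ∫ x, ⟪h.galerkinApprox (φ n) t x, g x⟫_ℝ) atTop (𝓝 (∫ x, ⟪w t x, g x⟫_ℝ)) := by
  have hW : ∀ n, MemLp (h.galerkinApprox (φ n) t) 2 volume := fun n => memLp_realTrigPoly _ _ 2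
  have hw := hl.memLp t ht
  have hE : ∀ n, ∫ x, ‖h.galerkinApprox (φ n) t x‖ ^ 2 ≤ ∫ x, ‖w₀ x‖ ^ 2 := by
    intro n
    rw [PVSetup.galerkinApprox, integral_norm_sq_realTrigPoly neg_mem_freqBall_of_mem (h.isConjSymm_galerkinCoeffAt (φ n) t)]
    have := h.sum_norm_sq_galerkinCoeffAt_le (φ n) (R := 0) (fun k _ _ => by rw [sq, zero_mul]; exact freqNormSq_nonneg k) ht
      (freqBall (φ n))
    simpa using this
  have hEw : ∫ x, ‖w t x‖ ^ 2 ≤ ∫ x, ‖w₀ x‖ ^ 2 := by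
    have := hl.integral_norm_sq_le (R := 0) (fun k _ _ => by rw [sq, zero_mul]; exact freqNormSq_nonneg k) ht
    simpa using this
  have hcoef : ∀ k, Tendsto (fun n => mFourierCoeff (EuclideanSpace.complexify ∘ h.galerkinApprox (φ n) t) k) atTop
      (𝓝 (mFourierCoeff (EuclideanSpace.complexify ∘ w t) k)) := by
    intro k
    rw [hl.coeff_eq t ht k]
    simp_rw [h.mFourierCoeff_galerkinApprox]
    exact hl.tendsto_coeff t ht k
  have hlim := Torus.tendsto_integral_inner_of_tendsto_mFourierCoeff hW hw hg hE hEw hcoef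
  have e1 : ∀ v : UnitAddTorus d → EuclideanSpace ℝ d, ∫ x, ⟪v x, g x⟫_ℝ = ∫ x, ⟪g x, v x⟫_ℝ := fun v =>
    integral_congr_ae (ae_of_all _ fun x => real_inner_comm _ _)
  rw [e1]
  simp_rw [e1]
  exact hlim

end WeakNull


end Torus

end Literature.Analysis.FluidPDE
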